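import Summits.NavierStokesRegularity.NavierStokesRegularity.Theorems.FilamentSkeletonRssSkeletonJ1RFrameDefs
import Literature.Analysis.FluidPDE.LeiZhang2011Proofs

/-!
# Route `FilamentSkeletonRss` · crux `SkeletonJ1R` (stmt-NavierStokesRegularity-23610) · stub F2 `LiaDefectL` — SELF-STRAND BRICK (S1):
# the exact first-order SPLIT of the Biot–Savart self-induction integrand and its segment-local Taylor bounds

Lead `ns-fsr-lead-23610` (g2), line `streamline_kantorovich_R` (skeleton of record v5, 77dea460483825b8).  Helper file
`--supports stmt-NavierStokesRegularity-23610`; route-independent (no `Theses` import).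

The self strand of the crux's regularised Biot–Savart field along a unit-speed curve `X` is
`S(τ) = ∫ K(‖X τ − X σ‖) • X′σ × (X τ − X σ) dσ`, `K(r) = ((r² + a)^{3/2})⁻¹`.  Stub F2 (defect rate of the LIA reference) needs its
local-induction asymptotics WITH LOGARITHMIC PRECISION (the `½ log Γ` of `liaCoeff`), along a curve whose curvature is NOT constant on the
logarithmic window (the S-bend grows linearly across the ball).  The tree's window lemma `SelectionBoxRJRung.nearStraight_liaReduction`
freezes `X″(τ)` on a window of half-width `≤ 1/2` and bounds everything else by the global tilt — too weak here (lead g0's F2-notes).  This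
file is the first brick of the replacement: an EXACT algebraic split of the integrand that keeps the full first-order structure,
* `cross_chord_split` : `X′σ × (X τ − X σ) = X′τ × A − R₂` with `A = (σ−τ)•X′σ − (X σ − X τ) = ∫_τ^σ (p − τ)•X″p dp` (first order in `X″`,
  NOT frozen at `τ`) and `R₂ = (X′σ − X′τ) × ((X σ − X τ) − (σ−τ)•X′τ)` (second order),
and the SEGMENT-LOCAL bounds the later bricks integrate against the kernel (the envelope of the reference curvature is linear in `|σ|`, so
every bound is stated with a constant valid on the segment `[[τ, σ]]` only, or with a tangent-oscillation constant for the far tail):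
* `norm_firstOrderTerm_le_of_curvature` : `‖A‖ ≤ κ (σ−τ)²`;  `norm_firstOrderTerm_le_of_osc` : `‖A‖ ≤ θ |σ−τ|`;
* `norm_firstOrderTerm_sub_model_le` : `‖A − ((σ−τ)²/2)•X″τ‖ ≤ H |σ−τ|³` when `X″` is `H`-Lipschitz about `τ` on the segment;
* `norm_taylorTwo_le_of_curvature` / `…_of_osc`, `norm_secondOrderTerm_le_of_curvature` : `‖R₂‖ ≤ κ² |σ−τ|³`, `…_of_osc` : `‖R₂‖ ≤ θ²|σ−τ|`.
HONEST FRAMING: MODEL rung, ∃-side helper lemmas (elementary calculus of curves) toward stub F2 of a HYPOTHETICAL filament-type blow-up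
skeleton; F2 and the crux 23610 stay OPEN; nothing here bears on Navier–Stokes regularity, which is NOT proved. [folklore]
-/

-- `dupNamespace` off: the module name repeats `NavierStokesRegularity` by the tree's `Summits/<S>/<S>/Theorems` layout (same as every sibling file).
set_option linter.dupNamespace false

noncomputable section

namespace Summit.NavierStokesRegularity.NavierStokesRegularity.Theorems.SkeletonJ1RLiaSelf

open MeasureTheory Set intervalIntegral
open Literature.Analysis.FluidPDE
open scoped RealInnerProductSpace InnerProductSpace BigOperators Interval

/-! ## §1 The algebraic split of the integrand -/

/-- **First-order split of the self-induction integrand.**  For vectors `T` (the tangent at `τ`), `Tσ` (the tangent at `σ`), points `P = X τ`,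
`Q = X σ` and the parameter difference `s = σ − τ`:
`Tσ × (P − Q) = T × (s•Tσ − (Q − P)) − (Tσ − T) × ((Q − P) − s•T)`.  Pure bilinearity (`T × T = 0`, anticommutativity). [folklore] -/
theorem cross_chord_split (T Tσ P Q : EuclideanSpace ℝ (Fin 3)) (s : ℝ) :
    cross Tσ (P - Q) = cross T (s • Tσ - (Q - P)) - cross (Tσ - T) ((Q - P) - s • T) := by
  ext i
  fin_cases i <;> simp [cross, crossProduct, smul_eq_mul] <;> ring

/-! ## §2 Segment-local Taylor bounds for a `C²` curve -/

variable {X : ℝ → EuclideanSpace ℝ (Fin 3)}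

/-- `X ∈ C²` ⇒ `X′ ∈ C¹` (numeral bookkeeping for `contDiff_succ_iff_deriv`). [folklore] -/
theorem contDiff_one_deriv (hX : ContDiff ℝ 2 X) : ContDiff ℝ 1 (deriv X) :=
  (contDiff_succ_iff_deriv.1 (show ContDiff ℝ (1 + 1) X from hX)).2.2

/-- `X ∈ C²` ⇒ `X″` is continuous. [folklore] -/
theorem continuous_deriv_two (hX : ContDiff ℝ 2 X) : Continuous (deriv (deriv X)) :=
  (contDiff_one_deriv hX).continuous_deriv le_rfl

/-- Tangent turning on a segment: `‖X′σ − X′τ‖ ≤ κ|σ − τ|` when `‖X″‖ ≤ κ` on `[[τ, σ]]`. [folklore] -/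
theorem norm_deriv_sub_deriv_le_on (hX : ContDiff ℝ 2 X) {τ σ κ : ℝ} (hκ : ∀ p ∈ uIcc τ σ, ‖deriv (deriv X) p‖ ≤ κ) :
    ‖deriv X σ - deriv X τ‖ ≤ κ * |σ - τ| := by
  have hd : Differentiable ℝ (deriv X) := hX.differentiable_deriv_two
  have h := Convex.norm_image_sub_le_of_norm_deriv_le (f := deriv X) (s := uIcc τ σ) (fun x _ => hd x)
    (fun x hx => hκ x hx) (convex_uIcc τ σ) left_mem_uIcc right_mem_uIcc
  rwa [Real.norm_eq_abs] at h

/-- The first-order term as an integral: `(σ−τ)•X′σ − (X σ − X τ) = ∫_τ^σ (X′σ − X′p) dp`. [folklore] -/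
theorem firstOrderTerm_eq_integral (hX : ContDiff ℝ 2 X) (τ σ : ℝ) :
    (σ - τ) • deriv X σ - (X σ - X τ) = ∫ p in τ..σ, (deriv X σ - deriv X p) := by
  have hd : Differentiable ℝ X := hX.differentiable (by norm_num)
  have hc : Continuous (deriv X) := hX.continuous_deriv (by norm_num)
  rw [intervalIntegral.integral_sub (continuous_const.intervalIntegrable _ _) (hc.intervalIntegrable _ _),
    intervalIntegral.integral_const, integral_deriv_eq_sub (fun x _ => hd x) (hc.intervalIntegrable _ _)]

/-- **First-order term, curvature bound**: `‖(σ−τ)•X′σ − (X σ − X τ)‖ ≤ κ (σ−τ)²` when `‖X″‖ ≤ κ` on `[[τ, σ]]`. [folklore] -/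
theorem norm_firstOrderTerm_le_of_curvature (hX : ContDiff ℝ 2 X) {τ σ κ : ℝ}
    (hκ : ∀ p ∈ uIcc τ σ, ‖deriv (deriv X) p‖ ≤ κ) :
    ‖(σ - τ) • deriv X σ - (X σ - X τ)‖ ≤ κ * (σ - τ) ^ 2 := by
  rw [firstOrderTerm_eq_integral hX τ σ]
  have hκ0 : 0 ≤ κ := le_trans (norm_nonneg _) (hκ τ left_mem_uIcc)
  have hb : ∀ p ∈ Ι τ σ, ‖deriv X σ - deriv X p‖ ≤ κ * |σ - τ| := by
    intro p hp
    have hp' : p ∈ uIcc τ σ := uIoc_subset_uIcc hp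
    have hsub : uIcc p σ ⊆ uIcc τ σ := uIcc_subset_uIcc hp' right_mem_uIcc
    have h1 := norm_deriv_sub_deriv_le_on hX (τ := p) (σ := σ) (κ := κ) fun q hq => hκ q (hsub hq)
    refine h1.trans (mul_le_mul_of_nonneg_left ?_ hκ0)
    rcases mem_uIcc.1 hp' with ⟨h1, h2⟩ | ⟨h1, h2⟩
    · rw [abs_of_nonneg (by linarith : (0:ℝ) ≤ σ - p), abs_of_nonneg (by linarith : (0:ℝ) ≤ σ - τ)]; linarith
    · rw [abs_of_nonpos (by linarith : σ - p ≤ 0), abs_of_nonpos (by linarith : σ - τ ≤ 0)]; linarith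
  have h := intervalIntegral.norm_integral_le_of_norm_le_const hb
  calc ‖∫ p in τ..σ, (deriv X σ - deriv X p)‖ ≤ κ * |σ - τ| * |σ - τ| := h
    _ = κ * (σ - τ) ^ 2 := by rw [mul_assoc, abs_mul_abs_self, sq]

/-- **First-order term, oscillation bound** (for the far tail): `‖(σ−τ)•X′σ − (X σ − X τ)‖ ≤ θ |σ − τ|` when `‖X′σ − X′p‖ ≤ θ` on `[[τ, σ]]`.
[folklore] -/
theorem norm_firstOrderTerm_le_of_osc (hX : ContDiff ℝ 2 X) {τ σ θ : ℝ} (hθ : ∀ p ∈ uIcc τ σ, ‖deriv X σ - deriv X p‖ ≤ θ) :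
    ‖(σ - τ) • deriv X σ - (X σ - X τ)‖ ≤ θ * |σ - τ| := by
  rw [firstOrderTerm_eq_integral hX τ σ]
  exact intervalIntegral.norm_integral_le_of_norm_le_const fun p hp => hθ p (uIoc_subset_uIcc hp)

/-- Second-order Taylor remainder as an integral: `X σ − X τ − (σ−τ)•X′τ = ∫_τ^σ (X′p − X′τ) dp`. [folklore] -/
theorem taylorTwo_eq_integral (hX : ContDiff ℝ 2 X) (τ σ : ℝ) :
    X σ - X τ - (σ - τ) • deriv X τ = ∫ p in τ..σ, (deriv X p - deriv X τ) := by
  have hd : Differentiable ℝ X := hX.differentiable (by norm_num)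
  have hc : Continuous (deriv X) := hX.continuous_deriv (by norm_num)
  rw [intervalIntegral.integral_sub (hc.intervalIntegrable _ _) (continuous_const.intervalIntegrable _ _),
    intervalIntegral.integral_const, integral_deriv_eq_sub (fun x _ => hd x) (hc.intervalIntegrable _ _)]

/-- **Taylor remainder, curvature bound**: `‖X σ − X τ − (σ−τ)•X′τ‖ ≤ κ (σ−τ)²` when `‖X″‖ ≤ κ` on `[[τ, σ]]`. [folklore] -/
theorem norm_taylorTwo_le_of_curvature (hX : ContDiff ℝ 2 X) {τ σ κ : ℝ} (hκ : ∀ p ∈ uIcc τ σ, ‖deriv (deriv X) p‖ ≤ κ) :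
    ‖X σ - X τ - (σ - τ) • deriv X τ‖ ≤ κ * (σ - τ) ^ 2 := by
  rw [taylorTwo_eq_integral hX τ σ]
  have hκ0 : 0 ≤ κ := le_trans (norm_nonneg _) (hκ τ left_mem_uIcc)
  have hb : ∀ p ∈ Ι τ σ, ‖deriv X p - deriv X τ‖ ≤ κ * |σ - τ| := by
    intro p hp
    have hp' : p ∈ uIcc τ σ := uIoc_subset_uIcc hp
    have hsub : uIcc τ p ⊆ uIcc τ σ := uIcc_subset_uIcc left_mem_uIcc hp'
    have h1 := norm_deriv_sub_deriv_le_on hX (τ := τ) (σ := p) (κ := κ) fun q hq => hκ q (hsub hq)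
    refine h1.trans (mul_le_mul_of_nonneg_left ?_ hκ0)
    rcases mem_uIcc.1 hp' with ⟨h1, h2⟩ | ⟨h1, h2⟩
    · rw [abs_of_nonneg (by linarith : (0:ℝ) ≤ p - τ), abs_of_nonneg (by linarith : (0:ℝ) ≤ σ - τ)]; linarith
    · rw [abs_of_nonpos (by linarith : p - τ ≤ 0), abs_of_nonpos (by linarith : σ - τ ≤ 0)]; linarith
  have h := intervalIntegral.norm_integral_le_of_norm_le_const hb
  calc ‖∫ p in τ..σ, (deriv X p - deriv X τ)‖ ≤ κ * |σ - τ| * |σ - τ| := h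
    _ = κ * (σ - τ) ^ 2 := by rw [mul_assoc, abs_mul_abs_self, sq]

/-- **Taylor remainder, oscillation bound**: `‖X σ − X τ − (σ−τ)•X′τ‖ ≤ θ |σ − τ|` when `‖X′p − X′τ‖ ≤ θ` on `[[τ, σ]]`. [folklore] -/
theorem norm_taylorTwo_le_of_osc (hX : ContDiff ℝ 2 X) {τ σ θ : ℝ} (hθ : ∀ p ∈ uIcc τ σ, ‖deriv X p - deriv X τ‖ ≤ θ) :
    ‖X σ - X τ - (σ - τ) • deriv X τ‖ ≤ θ * |σ - τ| := by
  rw [taylorTwo_eq_integral hX τ σ]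
  exact intervalIntegral.norm_integral_le_of_norm_le_const fun p hp => hθ p (uIoc_subset_uIcc hp)

/-- **Second-order term, curvature bound**: `‖(X′σ − X′τ) × ((X σ − X τ) − (σ−τ)•X′τ)‖ ≤ κ² |σ − τ|³` when `‖X″‖ ≤ κ` on `[[τ, σ]]`.
[folklore] -/
theorem norm_secondOrderTerm_le_of_curvature (hX : ContDiff ℝ 2 X) {τ σ κ : ℝ}
    (hκ : ∀ p ∈ uIcc τ σ, ‖deriv (deriv X) p‖ ≤ κ) :
    ‖cross (deriv X σ - deriv X τ) ((X σ - X τ) - (σ - τ) • deriv X τ)‖ ≤ κ ^ 2 * |σ - τ| ^ 3 := by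
  have hκ0 : 0 ≤ κ := le_trans (norm_nonneg _) (hκ τ left_mem_uIcc)
  have h1 := norm_deriv_sub_deriv_le_on hX hκ
  have h2 := norm_taylorTwo_le_of_curvature hX hκ
  calc ‖cross (deriv X σ - deriv X τ) ((X σ - X τ) - (σ - τ) • deriv X τ)‖
      ≤ ‖deriv X σ - deriv X τ‖ * ‖(X σ - X τ) - (σ - τ) • deriv X τ‖ := norm_cross_le_norm_mul_norm _ _
    _ ≤ (κ * |σ - τ|) * (κ * (σ - τ) ^ 2) := mul_le_mul h1 h2 (norm_nonneg _) (by positivity)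
    _ = κ ^ 2 * |σ - τ| ^ 3 := by rw [← sq_abs (σ - τ)]; ring

/-- **Second-order term, oscillation bound** (far tail): `‖(X′σ − X′τ) × ((X σ − X τ) − (σ−τ)•X′τ)‖ ≤ θ² |σ − τ|` when
`‖X′p − X′τ‖ ≤ θ` on `[[τ, σ]]`. [folklore] -/
theorem norm_secondOrderTerm_le_of_osc (hX : ContDiff ℝ 2 X) {τ σ θ : ℝ} (hθ : ∀ p ∈ uIcc τ σ, ‖deriv X p - deriv X τ‖ ≤ θ) :
    ‖cross (deriv X σ - deriv X τ) ((X σ - X τ) - (σ - τ) • deriv X τ)‖ ≤ θ ^ 2 * |σ - τ| := by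
  have hθ0 : 0 ≤ θ := le_trans (norm_nonneg _) (hθ τ left_mem_uIcc)
  have h1 : ‖deriv X σ - deriv X τ‖ ≤ θ := hθ σ right_mem_uIcc
  have h2 := norm_taylorTwo_le_of_osc hX hθ
  calc ‖cross (deriv X σ - deriv X τ) ((X σ - X τ) - (σ - τ) • deriv X τ)‖
      ≤ ‖deriv X σ - deriv X τ‖ * ‖(X σ - X τ) - (σ - τ) • deriv X τ‖ := norm_cross_le_norm_mul_norm _ _
    _ ≤ θ * (θ * |σ - τ|) := mul_le_mul h1 h2 (norm_nonneg _) hθ0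
    _ = θ ^ 2 * |σ - τ| := by ring

/-! ## §3 The first-order term against the frozen model `((σ−τ)²/2) • X″τ` (the logarithmic window) -/

/-- `(σ−τ)²/2 = ∫_τ^σ (σ − p) dp`. [folklore] -/
theorem integral_sub_self (τ σ : ℝ) : ∫ p in τ..σ, (σ - p) = (σ - τ) ^ 2 / 2 := by
  rw [intervalIntegral.integral_sub (continuous_const.intervalIntegrable _ _) intervalIntegrable_id,
    intervalIntegral.integral_const, integral_id]
  ring

/-- Tangent increment against the frozen curvature: `‖X′σ − X′p − (σ − p)•X″τ‖ ≤ H·|σ − τ|·|σ − p|` for `p ∈ [[τ, σ]]` when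
`‖X″q − X″τ‖ ≤ H|q − τ|` on `[[τ, σ]]`. [folklore] -/
theorem norm_deriv_sub_deriv_sub_smul_le (hX : ContDiff ℝ 2 X) {τ σ H : ℝ} (hH0 : 0 ≤ H)
    (hH : ∀ q ∈ uIcc τ σ, ‖deriv (deriv X) q - deriv (deriv X) τ‖ ≤ H * |q - τ|) {p : ℝ} (hp : p ∈ uIcc τ σ) :
    ‖deriv X σ - deriv X p - (σ - p) • deriv (deriv X) τ‖ ≤ H * |σ - τ| * |σ - p| := by
  have hd : Differentiable ℝ (deriv X) := hX.differentiable_deriv_two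
  have hc : Continuous (deriv (deriv X)) := continuous_deriv_two hX
  have heq : deriv X σ - deriv X p - (σ - p) • deriv (deriv X) τ =
      ∫ q in p..σ, (deriv (deriv X) q - deriv (deriv X) τ) := by
    rw [intervalIntegral.integral_sub (hc.intervalIntegrable _ _) (continuous_const.intervalIntegrable _ _),
      intervalIntegral.integral_const, integral_deriv_eq_sub (fun x _ => hd x) (hc.intervalIntegrable _ _)]
  rw [heq]
  have hsub : uIcc p σ ⊆ uIcc τ σ := uIcc_subset_uIcc hp right_mem_uIcc
  have hb : ∀ q ∈ Ι p σ, ‖deriv (deriv X) q - deriv (deriv X) τ‖ ≤ H * |σ - τ| := by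
    intro q hq
    have hq' : q ∈ uIcc τ σ := hsub (uIoc_subset_uIcc hq)
    refine (hH q hq').trans (mul_le_mul_of_nonneg_left ?_ hH0)
    rcases mem_uIcc.1 hq' with ⟨h1, h2⟩ | ⟨h1, h2⟩
    · rw [abs_of_nonneg (by linarith : (0:ℝ) ≤ q - τ), abs_of_nonneg (by linarith : (0:ℝ) ≤ σ - τ)]; linarith
    · rw [abs_of_nonpos (by linarith : q - τ ≤ 0), abs_of_nonpos (by linarith : σ - τ ≤ 0)]; linarith
  exact intervalIntegral.norm_integral_le_of_norm_le_const hb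

/-- **First-order term against the frozen model** (the logarithmic-window estimate's pointwise input): when the curvature is `H`-Lipschitz
about `τ` on `[[τ, σ]]` (`‖X″q − X″τ‖ ≤ H|q − τ|`), `‖(σ−τ)•X′σ − (X σ − X τ) − ((σ−τ)²/2)•X″τ‖ ≤ H |σ − τ|³`. [folklore] -/
theorem norm_firstOrderTerm_sub_model_le (hX : ContDiff ℝ 2 X) {τ σ H : ℝ} (hH0 : 0 ≤ H)
    (hH : ∀ q ∈ uIcc τ σ, ‖deriv (deriv X) q - deriv (deriv X) τ‖ ≤ H * |q - τ|) :
    ‖(σ - τ) • deriv X σ - (X σ - X τ) - ((σ - τ) ^ 2 / 2) • deriv (deriv X) τ‖ ≤ H * |σ - τ| ^ 3 := by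
  have hc : Continuous (deriv X) := hX.continuous_deriv (by norm_num)
  have I1 : IntervalIntegrable (fun p => deriv X σ - deriv X p) volume τ σ := (continuous_const.sub hc).intervalIntegrable _ _
  have I2 : IntervalIntegrable (fun p => (σ - p) • deriv (deriv X) τ) volume τ σ :=
    ((continuous_const.sub continuous_id).smul continuous_const).intervalIntegrable _ _
  have heq : (σ - τ) • deriv X σ - (X σ - X τ) - ((σ - τ) ^ 2 / 2) • deriv (deriv X) τ =
      ∫ p in τ..σ, (deriv X σ - deriv X p - (σ - p) • deriv (deriv X) τ) := by
    rw [intervalIntegral.integral_sub I1 I2, intervalIntegral.integral_smul_const, ← firstOrderTerm_eq_integral hX τ σ,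
      integral_sub_self]
  rw [heq]
  have hH1 : 0 ≤ H * |σ - τ| := by positivity
  have hb : ∀ p ∈ Ι τ σ, ‖deriv X σ - deriv X p - (σ - p) • deriv (deriv X) τ‖ ≤ H * |σ - τ| * |σ - τ| := by
    intro p hp
    have hp' : p ∈ uIcc τ σ := uIoc_subset_uIcc hp
    refine (norm_deriv_sub_deriv_sub_smul_le hX hH0 hH hp').trans (mul_le_mul_of_nonneg_left ?_ hH1)
    rcases mem_uIcc.1 hp' with ⟨h1, h2⟩ | ⟨h1, h2⟩
    · rw [abs_of_nonneg (by linarith : (0:ℝ) ≤ σ - p), abs_of_nonneg (by linarith : (0:ℝ) ≤ σ - τ)]; linarith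
    · rw [abs_of_nonpos (by linarith : σ - p ≤ 0), abs_of_nonpos (by linarith : σ - τ ≤ 0)]; linarith
  have h := intervalIntegral.norm_integral_le_of_norm_le_const hb
  calc ‖∫ p in τ..σ, (deriv X σ - deriv X p - (σ - p) • deriv (deriv X) τ)‖ ≤ H * |σ - τ| * |σ - τ| * |σ - τ| := h
    _ = H * |σ - τ| ^ 3 := by ring

end Summit.NavierStokesRegularity.NavierStokesRegularity.Theorems.SkeletonJ1RLiaSelf

end
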